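import Summits.CriticalPhenomena.SAWScalingLimit.Theorems.MassRatio.Negative.Walks
import Summits.CriticalPhenomena.SAWScalingLimit.Theorems.MassRatio.Negative.Tools
import Literature.Probability.RandomPlanarGeometry.HexParafermionSpinShift

/-!
# Crux `SAWDefectDecoherence.MassRatio` (stmt-CriticalPhenomena-8550), line `flat-root-arc-swap` — stub `stub_swapArcPositive`

**What it proves.** In the hypothesis frame of the crux `MassRatio` (the six curried
hypotheses: `0 < ρ`; flatness of `D` on `B(b, ρ)`, `b = D.pt 1`; the eventual admissibility
clause, whose third conjunct is `b_δ ∈ ∂Λ_δ` and whose last conjunct is the ROWS CLAUSE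
`δ·c_v ∈ B(b, ρ) → (v ∈ Λ_δ ↔ m_δ ≤ row v)`; exhaustion; `δ·mid a_δ → a`; `δ·mid b_δ → b`),
eventually as `δ → 0+` the ARC MASS `Σ_{a' ∈ S_δ} Z_{Λ_δ}(b_δ → a')` over the swap arc
`S_δ = {e ∈ ∂Λ_δ : ρ/4 ≤ |δ·mid e − b| ≤ ρ/2}` is positive, where
`Z_Λ(r → z) = ‖F_{Λ, r, x_c, σ = 0}(z)‖ = Σ_{γ ⊂ Λ : r → z} x_c^{ℓ(γ)}`. This is the divisor of
the line's glue `massRatioAt_of` (division by the arc mass).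

**How.** Fix `δ` with `0 < δ < ρ/100`, `|δ·mid b_δ − b| < ρ/100` and the admissibility clause.
(1) Door structure (`SwapArcPositive.door`): `b_δ = {u, v}`, `v ∈ Λ_δ`, `u ∉ Λ_δ`, `u ∼ v`; both
scaled centres are within `δ/2` of `δ·mid b_δ`, hence in `B(b, ρ)`, so the rows clause gives
`row u < m_δ ≤ row v`, and the only adjacency compatible with this (`Negative.adj_iff`) is the
vertical one: `u = bv (m_δ - 1) p₀`, `v = bv m_δ p₀`, `(p₀ - m_δ)` even (brick coordinates
`Negative.bv/row/pos`). (2) Run length (`run_length`): `n = ⌊3ρ/(8δ)⌋₊ ≥ 1`,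
`δ n ∈ (3ρ/8 − δ, 3ρ/8]`. (3) Every brick vertex of rows `m_δ - 1, m_δ` and positions
`p₀ … p₀ + 2n` has its scaled centre in `B(b, ρ)` (`center_mem_ball`: real offset `≤ δ n ≤ 3ρ/8`,
imaginary offset `≤ δ`), so by the rows clause the row-`m_δ` ones are in `Λ_δ` and the
row-`(m_δ - 1)` ones are not. (4) The horizontal run `c i = bv m_δ (p₀ + i)`, `i ≤ 2n`, entered
from `u` and leaving through `y = bv (m_δ - 1) (p₀ + 2n)`, is a self-avoiding walk of `Λ_δ` from
`b_δ` to the door edge `a' = {c (2n), y} ∈ ∂Λ_δ` (`Negative.corridorWalk`; `walk`), whence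
`Z_{Λ_δ}(b_δ → a') ≥ x_c^{2n+1} > 0` (`Negative.pow_length_le_norm_Z`). (5) `δ·mid a' − δ·mid b_δ
= δ n` is real, so `|δ·mid a' − b| ∈ [δ n − ρ/100, δ n + ρ/100] ⊂ [ρ/4, ρ/2]` (`target_dist`):
`a' ∈ S_δ`. (6) `S_δ` is finite (`Negative.hexDomainMidEdges_finite`) and all terms are norms, so
one positive term makes the `finsum` positive (`Negative.term_le_finsum_mem`).
-/

noncomputable section

namespace Summit.CriticalPhenomena.SAWScalingLimit.Theorems.MassRatio.ArcSwap

open Literature.Probability.LatticeModels Literature.Probability.RandomPlanarGeometry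
open Literature.Probability.RandomPlanarGeometry.SAW
open Summit.CriticalPhenomena.SAWScalingLimit.Theorems.MassRatio.Negative

open scoped Classical

namespace SwapArcPositive
/-! ### Helper lemmas for `stub_swapArcPositive` -/

/-- The scaled midpoint of the vertical door edge `{bv (r-1) p, bv r p}` (`p - r` even) is
`(δ(p+1)/2, δ·hgt·r)`. [folklore] -/
theorem scaled_door (δ : ℝ) {r p : ℤ} (h : (p - r) % 2 = 0) :
    (δ : ℂ) * hexMidpoint s(bv (r - 1) p, bv r p) = ⟨δ * ((p : ℝ) + 1) / 2, δ * hgt * (r : ℝ)⟩ := by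
  have hodd : (p - (r - 1)) % 2 = 1 := by omega
  apply Complex.ext
  · rw [Complex.re_ofReal_mul, mid_re, pos_bv, pos_bv]; simp; ring
  · rw [Complex.im_ofReal_mul, mid_im, im_center_bv_odd hodd, im_center_bv_even h]; simp; ring

/-- The same door edge written the other way round. [folklore] -/
theorem scaled_door' (δ : ℝ) {r p : ℤ} (h : (p - r) % 2 = 0) :
    (δ : ℂ) * hexMidpoint s(bv r p, bv (r - 1) p) = ⟨δ * ((p : ℝ) + 1) / 2, δ * hgt * (r : ℝ)⟩ := by
  rw [Sym2.eq_swap]; exact scaled_door δ h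

/-- **Door structure of the marked boundary edge.** A boundary mid-edge of `Λ₀` whose scaled
midpoint is `ρ/100`-close to the centre `bpt` of the rows ball is the vertical door edge
`{bv (m₀-1) p₀, bv m₀ p₀}` of the flat piece, `p₀ - m₀` even. [folklore] -/
theorem door {bpt : ℂ} {ρ δ : ℝ} {Λ₀ : Finset HexVertex} {m₀ : ℤ} {b₀ : Sym2 HexVertex}
    (hδ : 0 < δ) (hδρ : δ < ρ / 100) (hbd : b₀ ∈ hexDomainBoundary Λ₀)
    (hnear : dist ((δ : ℂ) * hexMidpoint b₀) bpt < ρ / 100)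
    (hrows : ∀ v : HexVertex, (δ : ℂ) * hexCenter v ∈ Metric.ball bpt ρ → (v ∈ Λ₀ ↔ m₀ ≤ v.1 1)) :
    ∃ p₀ : ℤ, (p₀ - m₀) % 2 = 0 ∧ b₀ = s(bv (m₀ - 1) p₀, bv m₀ p₀) := by
  obtain ⟨he, u, v, rfl, hv, hu⟩ := hbd
  have hadj : hexGraph.Adj u v := (SimpleGraph.mem_edgeSet _).1 he
  have h3 : (Real.sqrt 3)⁻¹ ≤ 1 := inv_le_one_of_one_le₀ (Real.one_le_sqrt.2 (by norm_num))
  -- both scaled centres are within `δ/2` of the scaled midpoint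
  have hcu : dist ((δ : ℂ) * hexCenter u) ((δ : ℂ) * hexMidpoint s(u, v)) ≤ δ / 2 := by
    rw [dist_eq_norm, hexMidpoint_mk]
    have e : (δ : ℂ) * hexCenter u - (δ : ℂ) * ((hexCenter u + hexCenter v) / 2) =
        ((δ / 2 : ℝ) : ℂ) * (hexCenter u - hexCenter v) := by push_cast; ring
    rw [e, norm_mul, Complex.norm_real, Real.norm_of_nonneg (by positivity),
      norm_hexCenter_sub_of_adj hadj.symm]
    calc δ / 2 * (Real.sqrt 3)⁻¹ ≤ δ / 2 * 1 := by gcongr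
      _ = δ / 2 := mul_one _
  have hcv : dist ((δ : ℂ) * hexCenter v) ((δ : ℂ) * hexMidpoint s(u, v)) ≤ δ / 2 := by
    rw [dist_eq_norm, hexMidpoint_mk]
    have e : (δ : ℂ) * hexCenter v - (δ : ℂ) * ((hexCenter u + hexCenter v) / 2) =
        ((δ / 2 : ℝ) : ℂ) * (hexCenter v - hexCenter u) := by push_cast; ring
    rw [e, norm_mul, Complex.norm_real, Real.norm_of_nonneg (by positivity),
      norm_hexCenter_sub_of_adj hadj]
    calc δ / 2 * (Real.sqrt 3)⁻¹ ≤ δ / 2 * 1 := by gcongr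
      _ = δ / 2 := mul_one _
  have hbu : (δ : ℂ) * hexCenter u ∈ Metric.ball bpt ρ := by
    rw [Metric.mem_ball]
    calc dist ((δ : ℂ) * hexCenter u) bpt
        ≤ dist ((δ : ℂ) * hexCenter u) ((δ : ℂ) * hexMidpoint s(u, v)) +
          dist ((δ : ℂ) * hexMidpoint s(u, v)) bpt := dist_triangle _ _ _
      _ < ρ := by linarith
  have hbv : (δ : ℂ) * hexCenter v ∈ Metric.ball bpt ρ := by
    rw [Metric.mem_ball]
    calc dist ((δ : ℂ) * hexCenter v) bpt
        ≤ dist ((δ : ℂ) * hexCenter v) ((δ : ℂ) * hexMidpoint s(u, v)) +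
          dist ((δ : ℂ) * hexMidpoint s(u, v)) bpt := dist_triangle _ _ _
      _ < ρ := by linarith
  -- rows clause: `row u < m₀ ≤ row v`, so the edge is vertical
  have hru : row u < m₀ := by
    by_contra hc
    exact hu ((hrows u hbu).2 (not_lt.1 hc))
  have hrv : m₀ ≤ row v := (hrows v hbv).1 hv
  rw [adj_iff] at hadj
  rcases hadj with ⟨h1, -⟩ | ⟨-, h2, -⟩ | ⟨h1, h2, h3⟩
  · exfalso; omega
  · exfalso; omega
  · have hru' : row u = m₀ - 1 := by omega
    have hrv' : row v = m₀ := by omega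
    have eu : bv (m₀ - 1) (pos v) = u := by rw [← h1, ← hru']; exact bv_row_pos u
    have ev : bv m₀ (pos v) = v := by rw [← hrv']; exact bv_row_pos v
    exact ⟨pos v, by omega, by rw [eu, ev]⟩

/-- **Run length.** For `0 < δ < 3ρ/8` there is `n ≥ 1` with `δ n ∈ (3ρ/8 - δ, 3ρ/8]`. [folklore] -/
theorem run_length {ρ δ : ℝ} (hδ : 0 < δ) (hδρ : δ < 3 * ρ / 8) :
    ∃ n : ℕ, 0 < n ∧ δ * n ≤ 3 * ρ / 8 ∧ 3 * ρ / 8 - δ < δ * n := by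
  have hρ : 0 < ρ := by linarith
  have e : δ * (3 * ρ / (8 * δ)) = 3 * ρ / 8 := by field_simp
  refine ⟨⌊3 * ρ / (8 * δ)⌋₊, ?_, ?_, ?_⟩
  · exact Nat.floor_pos.2 (by rw [le_div_iff₀ (by positivity)]; linarith)
  · have h := Nat.floor_le (show (0:ℝ) ≤ 3 * ρ / (8 * δ) by positivity)
    calc δ * (⌊3 * ρ / (8 * δ)⌋₊ : ℝ) ≤ δ * (3 * ρ / (8 * δ)) := by gcongr
      _ = 3 * ρ / 8 := e
  · have h := Nat.lt_floor_add_one (3 * ρ / (8 * δ))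
    have h' := mul_lt_mul_of_pos_left h hδ
    linarith

/-- **Centres near the door are in the rows ball.** A brick vertex of row `m₀` or `m₀ - 1` and
position in `[p₀, p₀ + 2n]`, `δ n ≤ 3ρ/8`, has scaled centre in `B(bpt, ρ)`. [folklore] -/
theorem center_mem_ball {bpt : ℂ} {ρ δ : ℝ} {m₀ p₀ : ℤ} {n : ℕ} (hδ : 0 < δ) (hδρ : δ < ρ / 100)
    (hn : δ * n ≤ 3 * ρ / 8) (hpar : (p₀ - m₀) % 2 = 0)
    (hnear : dist ((δ : ℂ) * hexMidpoint s(bv (m₀ - 1) p₀, bv m₀ p₀)) bpt < ρ / 100)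
    (r p : ℤ) (hr : r = m₀ ∨ r = m₀ - 1) (hp1 : p₀ ≤ p) (hp2 : p ≤ p₀ + 2 * n) :
    (δ : ℂ) * hexCenter (bv r p) ∈ Metric.ball bpt ρ := by
  rw [Metric.mem_ball]
  have hd : dist ((δ : ℂ) * hexCenter (bv r p)) ((δ : ℂ) * hexMidpoint s(bv (m₀ - 1) p₀, bv m₀ p₀))
      ≤ 3 * ρ / 8 + δ := by
    have i1 := im_scaled_ge δ hδ.le (bv r p)
    have i2 := im_scaled_le δ hδ.le (bv r p)
    rw [row_bv] at i1 i2
    rw [scaled_door δ hpar, Complex.dist_eq]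
    refine (Complex.norm_le_abs_re_add_abs_im _).trans ?_
    simp only [Complex.sub_re, Complex.sub_im, re_scaled, pos_bv]
    have hp1' : (p₀ : ℝ) ≤ p := by exact_mod_cast hp1
    have hp2' : (p : ℝ) ≤ p₀ + 2 * n := by exact_mod_cast hp2
    have hg := hgt_pos
    have hδh : δ * hgt ≤ δ := by nlinarith [hgt_lt]
    have hp0 : 0 ≤ δ * hgt := by positivity
    have e1 : |δ * ((p : ℝ) + 1) / 2 - δ * ((p₀ : ℝ) + 1) / 2| ≤ 3 * ρ / 8 := by
      rw [abs_le]
      constructor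
      · nlinarith [mul_le_mul_of_nonneg_left hp1' hδ.le]
      · nlinarith [mul_le_mul_of_nonneg_left hp2' hδ.le]
    have e2 : |((δ : ℂ) * hexCenter (bv r p)).im - δ * hgt * (m₀ : ℝ)| ≤ δ := by
      rw [abs_le]
      rcases hr with rfl | rfl
      · constructor <;> linarith
      · push_cast at i1 i2
        constructor <;> linarith
    linarith
  calc dist ((δ : ℂ) * hexCenter (bv r p)) bpt
      ≤ dist ((δ : ℂ) * hexCenter (bv r p)) ((δ : ℂ) * hexMidpoint s(bv (m₀ - 1) p₀, bv m₀ p₀)) +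
        dist ((δ : ℂ) * hexMidpoint s(bv (m₀ - 1) p₀, bv m₀ p₀)) bpt := dist_triangle _ _ _
    _ < ρ := by linarith

/-- **The run along row `m₀`.** If inside rows `m₀ - 1, m₀` and positions `[p₀, p₀ + 2n]`
membership in `Λ₀` is `row ≥ m₀`, then the horizontal run `bv m₀ (p₀ + i)`, `i ≤ 2n`, is a
self-avoiding walk of `Λ₀` from the door `{bv (m₀-1) p₀, bv m₀ p₀}` to the door
`{bv m₀ (p₀+2n), bv (m₀-1) (p₀+2n)}`, which is a boundary mid-edge of `Λ₀`. [folklore] -/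
theorem walk {Λ₀ : Finset HexVertex} {m₀ p₀ : ℤ} {n : ℕ} (hn : 0 < n) (hpar : (p₀ - m₀) % 2 = 0)
    (hmem : ∀ r p : ℤ, (r = m₀ ∨ r = m₀ - 1) → p₀ ≤ p → p ≤ p₀ + 2 * n → (bv r p ∈ Λ₀ ↔ m₀ ≤ r)) :
    Nonempty (HexMidEdgeSAW Λ₀ s(bv (m₀ - 1) p₀, bv m₀ p₀)
      s(bv m₀ (p₀ + 2 * n), bv (m₀ - 1) (p₀ + 2 * n))) ∧
    s(bv m₀ (p₀ + 2 * n), bv (m₀ - 1) (p₀ + 2 * n)) ∈ hexDomainBoundary Λ₀ := by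
  have hin : ∀ p : ℤ, p₀ ≤ p → p ≤ p₀ + 2 * n → bv m₀ p ∈ Λ₀ := fun p h1 h2 =>
    (hmem m₀ p (Or.inl rfl) h1 h2).2 le_rfl
  have hout : ∀ p : ℤ, p₀ ≤ p → p ≤ p₀ + 2 * n → bv (m₀ - 1) p ∉ Λ₀ := fun p h1 h2 h =>
    absurd ((hmem (m₀ - 1) p (Or.inr rfl) h1 h2).1 h) (by omega)
  have hadjL : hexGraph.Adj (bv m₀ (p₀ + 2 * n)) (bv (m₀ - 1) (p₀ + 2 * n)) := by
    rw [adj_bv_iff]; right; left; exact ⟨rfl, rfl, by omega⟩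
  refine ⟨?_, (SimpleGraph.mem_edgeSet _).2 hadjL, bv (m₀ - 1) (p₀ + 2 * n), bv m₀ (p₀ + 2 * n),
    Sym2.eq_swap, hin _ (by omega) le_rfl, hout _ (by omega) le_rfl⟩
  set L : ℕ := 2 * n with hL
  have hLeq : (L : ℤ) = 2 * n := by rw [hL]; push_cast; ring
  set c : ℕ → HexVertex := fun i => bv m₀ (p₀ + i) with hc
  have ha : s(bv (m₀ - 1) p₀, bv m₀ p₀) = s(bv (m₀ - 1) p₀, c 0) := by simp [hc]
  have hb : s(bv m₀ (p₀ + 2 * n), bv (m₀ - 1) (p₀ + 2 * n)) = s(c L, bv (m₀ - 1) (p₀ + L)) := by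
    simp only [hc, hLeq]
  rw [ha, hb]
  refine ⟨corridorWalk (Λ := Λ₀) (c := c) (L := L) ?_ ?_ ?_ ?_ ?_ ?_ ?_⟩
  · intro i hi; simp only [hc]; exact hin _ (by omega) (by omega)
  · intro i j _ _ h; simp only [hc] at h; have := (bv_inj h).2; omega
  · intro i _; simp only [hc]; rw [adj_bv_iff]; left; exact ⟨rfl, Or.inl (by push_cast; ring)⟩
  · simp only [hc, Nat.cast_zero, add_zero]
    rw [adj_bv_iff]; right; right; exact ⟨rfl, by ring, by omega⟩
  · exact hout _ le_rfl (by omega)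
  · exact hout _ (by omega) (by omega)
  · intro h
    simp only [hc] at h
    rcases Sym2.eq_iff.1 h with ⟨h1, -⟩ | ⟨h1, -⟩
    · have := (bv_inj h1).1; omega
    · have := (bv_inj h1).2; omega

/-- A mid-edge reached by some self-avoiding walk carries positive `σ = 0` mass. [folklore] -/
theorem norm_pos_of_nonempty {Λ₀ : Finset HexVertex} {A Z : Sym2 HexVertex}
    (h : Nonempty (HexMidEdgeSAW Λ₀ A Z)) :
    0 < ‖hexParafermionicObservable Λ₀ A hexCriticalFugacity 0 Z‖ := by
  obtain ⟨γ⟩ := h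
  exact lt_of_lt_of_le (pow_pos hexCriticalFugacity_pos_lt_one.1 _)
    (pow_length_le_norm_Z Λ₀ A Z γ hexCriticalFugacity_pos_lt_one.1.le)

/-- **The far door is on the swap arc.** With `δ n ∈ (3ρ/8 - δ, 3ρ/8]`, `δ < ρ/100` and the near
door `ρ/100`-close to `bpt`, the door at position `p₀ + 2n` has scaled midpoint at distance
`∈ [ρ/4, ρ/2]` from `bpt` (the two midpoints differ by the real number `δ n`). [folklore] -/
theorem target_dist {bpt : ℂ} {ρ δ : ℝ} {m₀ p₀ : ℤ} {n : ℕ} (hδ : 0 < δ) (hδρ : δ < ρ / 100)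
    (hn1 : δ * n ≤ 3 * ρ / 8) (hn2 : 3 * ρ / 8 - δ < δ * n) (hpar : (p₀ - m₀) % 2 = 0)
    (hnear : dist ((δ : ℂ) * hexMidpoint s(bv (m₀ - 1) p₀, bv m₀ p₀)) bpt < ρ / 100) :
    ρ / 4 ≤ dist ((δ : ℂ) * hexMidpoint s(bv m₀ (p₀ + 2 * n), bv (m₀ - 1) (p₀ + 2 * n))) bpt ∧
    dist ((δ : ℂ) * hexMidpoint s(bv m₀ (p₀ + 2 * n), bv (m₀ - 1) (p₀ + 2 * n))) bpt ≤ ρ / 2 := by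
  have hpar' : (p₀ + 2 * n - m₀) % 2 = 0 := by omega
  have hd : dist ((δ : ℂ) * hexMidpoint s(bv m₀ (p₀ + 2 * n), bv (m₀ - 1) (p₀ + 2 * n)))
      ((δ : ℂ) * hexMidpoint s(bv (m₀ - 1) p₀, bv m₀ p₀)) = δ * n := by
    rw [scaled_door' δ hpar', scaled_door δ hpar, Complex.dist_eq]
    have e : ((⟨δ * (((p₀ + 2 * n : ℤ) : ℝ) + 1) / 2, δ * hgt * (m₀ : ℝ)⟩ : ℂ) -
        ⟨δ * ((p₀ : ℝ) + 1) / 2, δ * hgt * (m₀ : ℝ)⟩) = ((δ * n : ℝ) : ℂ) := by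
      apply Complex.ext
      · simp; ring
      · simp
    rw [e, Complex.norm_real, Real.norm_of_nonneg (by positivity)]
  have t1 := dist_triangle ((δ : ℂ) * hexMidpoint s(bv m₀ (p₀ + 2 * n), bv (m₀ - 1) (p₀ + 2 * n)))
    ((δ : ℂ) * hexMidpoint s(bv (m₀ - 1) p₀, bv m₀ p₀)) bpt
  have t2 := dist_triangle ((δ : ℂ) * hexMidpoint s(bv m₀ (p₀ + 2 * n), bv (m₀ - 1) (p₀ + 2 * n)))
    bpt ((δ : ℂ) * hexMidpoint s(bv (m₀ - 1) p₀, bv m₀ p₀))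
  rw [dist_comm bpt] at t2
  constructor <;> linarith

/-- **One fixed mesh.** For `0 < δ < ρ/100`, a boundary mid-edge `b₀` of `Λ₀` with
`|δ·mid b₀ - bpt| < ρ/100` and the rows clause in `B(bpt, ρ)`, the arc mass
`Σ_{a' ∈ S} Z_{Λ₀}(b₀ → a')`, `S = {e ∈ ∂Λ₀ : ρ/4 ≤ |δ·mid e − bpt| ≤ ρ/2}`, is positive. [folklore] -/
theorem main {bpt : ℂ} {ρ δ : ℝ} {Λ₀ : Finset HexVertex} {m₀ : ℤ} {b₀ : Sym2 HexVertex}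
    (hδ : 0 < δ) (hδρ : δ < ρ / 100) (hbd : b₀ ∈ hexDomainBoundary Λ₀)
    (hnear : dist ((δ : ℂ) * hexMidpoint b₀) bpt < ρ / 100)
    (hrows : ∀ v : HexVertex, (δ : ℂ) * hexCenter v ∈ Metric.ball bpt ρ → (v ∈ Λ₀ ↔ m₀ ≤ v.1 1)) :
    0 < ∑ᶠ a' ∈ {e : Sym2 HexVertex | e ∈ hexDomainBoundary Λ₀ ∧
          ρ / 4 ≤ dist ((δ : ℂ) * hexMidpoint e) bpt ∧ dist ((δ : ℂ) * hexMidpoint e) bpt ≤ ρ / 2},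
          ‖hexParafermionicObservable Λ₀ b₀ hexCriticalFugacity 0 a'‖ := by
  obtain ⟨p₀, hpar, rfl⟩ := door hδ hδρ hbd hnear hrows
  obtain ⟨n, hn, hn1, hn2⟩ := run_length (ρ := ρ) hδ (by linarith)
  have hmem : ∀ r p : ℤ, (r = m₀ ∨ r = m₀ - 1) → p₀ ≤ p → p ≤ p₀ + 2 * n →
      (bv r p ∈ Λ₀ ↔ m₀ ≤ r) := by
    intro r p hr hp1 hp2
    have h := hrows (bv r p) (center_mem_ball hδ hδρ hn1 hpar hnear r p hr hp1 hp2)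
    rwa [show (bv r p).1 1 = r from row_bv r p] at h
  obtain ⟨hne, hbd'⟩ := walk hn hpar hmem
  obtain ⟨hlo, hhi⟩ := target_dist hδ hδρ hn1 hn2 hpar hnear
  have hfin : {e : Sym2 HexVertex | e ∈ hexDomainBoundary Λ₀ ∧
      ρ / 4 ≤ dist ((δ : ℂ) * hexMidpoint e) bpt ∧
      dist ((δ : ℂ) * hexMidpoint e) bpt ≤ ρ / 2}.Finite :=
    (hexDomainMidEdges_finite Λ₀).subset fun e he => hexDomainBoundary_subset Λ₀ he.1
  have key := term_le_finsum_mem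
    (f := fun a' => ‖hexParafermionicObservable Λ₀ s(bv (m₀ - 1) p₀, bv m₀ p₀)
      hexCriticalFugacity 0 a'‖) hfin (fun _ => norm_nonneg _)
    (show s(bv m₀ (p₀ + 2 * n), bv (m₀ - 1) (p₀ + 2 * n)) ∈ {e : Sym2 HexVertex |
      e ∈ hexDomainBoundary Λ₀ ∧ ρ / 4 ≤ dist ((δ : ℂ) * hexMidpoint e) bpt ∧
      dist ((δ : ℂ) * hexMidpoint e) bpt ≤ ρ / 2} from ⟨hbd', hlo, hhi⟩)
  exact lt_of_lt_of_le (norm_pos_of_nonempty hne) key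

end SwapArcPositive

/-- **Stub 3 of the line `flat-root-arc-swap` — `SwapArcPositive` (non-degeneracy of the swap
arc).** In the hypothesis frame of the crux `MassRatio`, eventually as `δ → 0+` the arc mass
`Σ_{a' ∈ S_δ} Z_{Λ_δ}(b_δ → a')` over the swap arc
`S_δ = {e ∈ ∂Λ_δ : ρ/4 ≤ |δ·mid e − b| ≤ ρ/2}` is positive: by `b_δ ∈ ∂Λ_δ`, `δ·mid b_δ → b`
and the rows clause, `b_δ` is eventually a vertical door edge of the flat zigzag piece, and the
horizontal run along the bottom row `m_δ` reaches, inside `Λ_δ ∩ B(b, ρ)`, a door edge of `S_δ`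
(`SwapArcPositive.main`). Uses `0 < ρ`, the rows clause and `δ·mid b_δ → b`; flatness of `D`,
exhaustion and `δ·mid a_δ → a` are not needed. [folklore] -/
theorem stub_swapArcPositive :
    ∀ (D : DobrushinDomain) (ρ : ℝ) (Λ : ℝ → Finset HexVertex) (m : ℝ → ℤ)
      (a b : ℝ → Sym2 HexVertex),
      0 < ρ →
      D.carrier ∩ Metric.ball (D.pt 1) ρ = {z : ℂ | (D.pt 1).im < z.im} ∩ Metric.ball (D.pt 1) ρ →
      (∀ᶠ δ : ℝ in nhdsWithin 0 (Set.Ioi 0),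
        hexDomainSimplyConnected (Λ δ) ∧ a δ ∈ hexDomainBoundary (Λ δ) ∧
          b δ ∈ hexDomainBoundary (Λ δ) ∧ Nonempty (HexMidEdgeSAW (Λ δ) (a δ) (b δ)) ∧
          (hexGraph.induce ((Λ δ : Finset HexVertex) : Set HexVertex)).Preconnected ∧
          (∀ v ∈ Λ δ, (δ : ℂ) * hexCenter v ∈ D.carrier) ∧
          (∀ v : HexVertex, (δ : ℂ) * hexCenter v ∈ Metric.ball (D.pt 1) ρ →
            (v ∈ Λ δ ↔ m δ ≤ v.1 1))) →
      (∀ K : Set ℂ, IsCompact K → K ⊆ D.carrier → ∀ᶠ δ : ℝ in nhdsWithin 0 (Set.Ioi 0),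
        ∀ v : HexVertex, (δ : ℂ) * hexCenter v ∈ K → v ∈ Λ δ) →
      Filter.Tendsto (fun δ : ℝ => (δ : ℂ) * hexMidpoint (a δ)) (nhdsWithin 0 (Set.Ioi 0))
        (nhds (D.pt 0)) →
      Filter.Tendsto (fun δ : ℝ => (δ : ℂ) * hexMidpoint (b δ)) (nhdsWithin 0 (Set.Ioi 0))
        (nhds (D.pt 1)) →
      ∀ᶠ δ : ℝ in nhdsWithin 0 (Set.Ioi 0),
        0 < ∑ᶠ a' ∈ {e : Sym2 HexVertex | e ∈ hexDomainBoundary (Λ δ) ∧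
              ρ / 4 ≤ dist ((δ : ℂ) * hexMidpoint e) (D.pt 1) ∧
              dist ((δ : ℂ) * hexMidpoint e) (D.pt 1) ≤ ρ / 2},
              ‖hexParafermionicObservable (Λ δ) (b δ) hexCriticalFugacity 0 a'‖ := by
  intro D ρ Λ m a b hρ _hflat hadm _hexh _ha hb
  have h1 : ∀ᶠ δ : ℝ in nhdsWithin 0 (Set.Ioi 0),
      dist ((δ : ℂ) * hexMidpoint (b δ)) (D.pt 1) < ρ / 100 :=
    Metric.tendsto_nhds.1 hb (ρ / 100) (by positivity)
  have h2 : ∀ᶠ δ : ℝ in nhdsWithin 0 (Set.Ioi 0), 0 < δ ∧ δ < ρ / 100 := by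
    filter_upwards [Ioo_mem_nhdsGT (show (0 : ℝ) < ρ / 100 by positivity)] with δ hδ
    exact ⟨hδ.1, hδ.2⟩
  filter_upwards [hadm, h1, h2] with δ hA hB hC
  obtain ⟨-, -, hbd, -, -, -, hrows⟩ := hA
  exact SwapArcPositive.main hC.1 hC.2 hbd hB hrows

end Summit.CriticalPhenomena.SAWScalingLimit.Theorems.MassRatio.ArcSwap
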